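import Summits.AtomisticToContinuum.HydrodynamicLimit.Theses.InformationPercolationEngine
import Summits.AtomisticToContinuum.HydrodynamicLimit.Theorems.InformationPercolationEngineCollisionRateTubeRegular
import Summits.AtomisticToContinuum.HydrodynamicLimit.Theorems.JParityClosureEvenStressEnskogKineticEnergyTight
import Literature.MathematicalPhysics.KineticTheory.EnskogRateWindowReduction
import HarnessLib

/-!
# Window reduction of the Enskog term of `CollisionRate` (`stub_windowReductionEnskog`, S4b of the line
# `Sketch` / card `hazard-fairness-compensator`, crux `InformationPercolationEngine.CollisionRate`,
# stmt-AtomisticToContinuum-13481)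

The crux statistic is `evenStat σ N Φ τ χ g 1 r = collisionSum − σ³∫₀^τ e_s(Φ_s z) ds` with
`e_t = enskogRate σ N χ g 1 r t` (constant mark: Enskog's collision frequency).  This file proves the
registered stub S4b: GIVEN the route's tail support `CollisionMomentBound` (stmt-15144, an antecedent),
there is a band `η₄ > 0` such that for continuous positive profiles, `σ < σ₀`, every flow family, `τ > 0`,
continuous `χ`, continuous `g` vanishing on `[η₄, ∞)`, `η, δ, r > 0`, there is `a₁ > 0` with: for every
window fraction `a ∈ (0, a₁)`, eventually in `N`,
`P_{LG}(|σ³ ∫_{[0,τ]} e_s(Φ_s z) ds − riemannEnskog σ N Φ τ a χ g r z| > η) ≤ δ` — the Enskog time integral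
is its left Riemann sum over the window starts `kw`, `k < Kw`, `w = windowLen N τ a ≤ a (N+1)^{-1/3}`, up to a
small error in probability.

Proof.  PATHWISE (`Literature.….abs_enskogIntegral_sub_riemannEnskog_le`, tree): on a good orbit with
kinetic energy `≤ K(N+1)`, `|σ³∫ e − RE| ≤ σ³{τ(ω C_G M_B + C_χ ϵ_G + 8π C_χ C_G L M K w) + 4π C_χ C_G M² (w/(N+1))
· CPS((0,τ])}` where `ω` is the time modulus of `χ` over `w` (uniform continuity on `[0,τ] × 𝕋³`),
`(κ, ϵ_G)` a modulus of `(g·Y)(b)·B` (`exists_modulus_mul_le`: `g·Y` is bounded on `[0, ∞)` and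
CONTINUOUS ON `(0, ∞)` — `exists_band_mul_contactValue` below, from the proved equation of state
`HsEosLowDensity`: `Y = (3/2π) f_ex′` is continuous on the open analyticity band, `g = 0` beyond `η₄`; the
junk value `Y 0 = 0` is never used because the pair functional vanishes with the density), and `CPS` the
collision pair sum of `1 + ‖vᵢ‖² + ‖vⱼ‖²`, which is `(N+1)/ε` times the functional of `CollisionMomentBound`
(`collisionPairSum_eq_finsum_ite`); `w/ε ≤ a/σ`.  IN PROBABILITY: the four terms are each `≤ η/4` for
`a < a₁(η, σ, τ, r, C_χ, C_G, K, K_b)` on the event {good} ∩ {E ≤ K(N+1)} ∩ {functional ≤ K_b}, whose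
complement has probability `≤ 0 + δ/2 + δ/2` (`localGibbsLaw_compl_good_eq_zero`,
`Theorems.EvenStressEnskog.stub_kineticEnergyTight`, `CollisionMomentBound`).
-/

noncomputable section

open MeasureTheory Set Filter Topology
open scoped ENNReal InnerProductSpace BigOperators

namespace Summit.AtomisticToContinuum.HydrodynamicLimit.Theorems.CollisionRate

open Summit.AtomisticToContinuum.HydrodynamicLimit.Theses.InformationPercolationEngine
open Literature.Analysis.FluidPDE Literature.MathematicalPhysics.KineticTheory
open Summit.AtomisticToContinuum.HydrodynamicLimit.Theorems.EvenStressEnskog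
  (exists_bound_mul_contactValue stub_kineticEnergyTight)

/-! ## The band: `g · Y` is bounded on `[0, ∞)` and continuous on `(0, ∞)` -/

/-- **The equation of state makes `g·Y` bounded on `[0, ∞)` and continuous on `(0, ∞)`.**  From the proved
`HsEosLowDensity` (`F` analytic on `(−η₁, η₁)`, `f_ex = F` on `[0, η₁)`): with `η₄ := min η₀ (η₁/2)` (`η₀`
the band of `exists_bound_mul_contactValue`), for every continuous `g` vanishing on `[η₄, ∞)` the function
`a ↦ g(a)·Y(a)` (`Y = contactValue = (3/2π)·deriv f_ex`) is continuous at every `a > 0` — on `(0, η₁)`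
because `deriv f_ex = deriv F` near `a` (open band), beyond because it vanishes near `a` — and bounded on
`[0, ∞)`.  Nothing is claimed at `a = 0` (junk value `Y 0 = 0`). [folklore] -/
theorem exists_band_mul_contactValue :
    ∃ η₄ : ℝ, 0 < η₄ ∧ ∀ g : ℝ → ℝ, Continuous g → (∀ a, η₄ ≤ a → g a = 0) →
      ContinuousOn (fun a => g a * contactValue a) (Set.Ioi 0) ∧
      ∃ C : ℝ, 0 ≤ C ∧ ∀ a, 0 ≤ a → |g a * contactValue a| ≤ C := by
  obtain ⟨η₀, hη₀, hbound⟩ := exists_bound_mul_contactValue hsEosLowDensity_JParityClosure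
  obtain ⟨η₁, hη₁, F, hF, hEq, -⟩ := hsEosLowDensity_JParityClosure
  refine ⟨min η₀ (η₁ / 2), lt_min hη₀ (half_pos hη₁), fun g hg hg0 => ⟨?_, ?_⟩⟩
  · intro a ha
    refine ContinuousAt.continuousWithinAt ?_
    by_cases h1 : a < η₁
    · have hmem : Ioo (-η₁) η₁ ∈ 𝓝 a := isOpen_Ioo.mem_nhds ⟨by linarith [mem_Ioi.1 ha], h1⟩
      have hnhds : hsExcessFreeEnergy =ᶠ[𝓝 a] F :=
        Filter.eventuallyEq_of_mem (isOpen_Ioo.mem_nhds ⟨mem_Ioi.1 ha, h1⟩)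
          (hEq.mono (Ioo_subset_Ico_self : Ioo 0 η₁ ⊆ Ico 0 η₁))
      have hFc : ContinuousAt (deriv F) a := hF.deriv.continuousOn.continuousAt hmem
      have hd : ContinuousAt (deriv hsExcessFreeEnergy) a := hFc.congr_of_eventuallyEq hnhds.deriv
      have hY : ContinuousAt contactValue a := by
        have e : contactValue = fun b => 3 / (2 * Real.pi) * deriv hsExcessFreeEnergy b := rfl
        rw [e]
        exact continuousAt_const.mul hd
      exact hg.continuousAt.mul hY
    · push Not at h1
      have hev : (fun b => g b * contactValue b) =ᶠ[𝓝 a] fun _ => (0 : ℝ) := by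
        filter_upwards [Ioi_mem_nhds (show η₁ / 2 < a by linarith)] with b hb
        rw [hg0 b ((min_le_right _ _).trans (le_of_lt hb)), zero_mul]
      exact continuousAt_const.congr_of_eventuallyEq hev
  · exact hbound g hg fun a ha' => hg0 a ((min_le_left _ _).trans ha')

/-! ## The time modulus of the localiser -/

/-- A continuous localiser `χ` on `ℝ × 𝕋³` has a uniform time modulus on `[0, τ]`: for `ω > 0` there is
`κ > 0` with `|χ(s, y) − χ(s', y)| ≤ ω` for `s, s' ∈ [0, τ]`, `|s − s'| < κ`, all `y` (uniform continuity
on the compact `[0, τ] × 𝕋³`). [folklore] -/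
theorem exists_time_modulus {χ : ℝ × T3 → ℝ} (hχ : Continuous χ) (τ : ℝ) {ω : ℝ} (hω : 0 < ω) :
    ∃ κ : ℝ, 0 < κ ∧ ∀ s ∈ Icc (0 : ℝ) τ, ∀ s' ∈ Icc (0 : ℝ) τ, |s - s'| < κ →
      ∀ y, |χ (s, y) - χ (s', y)| ≤ ω := by
  have hK : IsCompact (Icc (0 : ℝ) τ ×ˢ (univ : Set T3)) := isCompact_Icc.prod isCompact_univ
  have hUC := Metric.uniformContinuousOn_iff.1 (hK.uniformContinuousOn_of_continuous hχ.continuousOn)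
  obtain ⟨κ, hκ, hU⟩ := hUC ω hω
  refine ⟨κ, hκ, fun s hs s' hs' hss' y => ?_⟩
  have hd : dist (s, y) (s', y) < κ := by
    rw [Prod.dist_eq, dist_self, max_eq_left dist_nonneg, Real.dist_eq]
    exact hss'
  have h := hU (s, y) ⟨hs, mem_univ _⟩ (s', y) ⟨hs', mem_univ _⟩ hd
  rw [Real.dist_eq] at h
  exact h.le

/-! ## Elementary inequalities for the choice of the window fraction -/

/-- `η/(4(Q+1)) · Q ≤ η/4` for `Q, η ≥ 0`. [folklore] -/
theorem div_four_mul_le {η Q : ℝ} (hη : 0 ≤ η) (hQ : 0 ≤ Q) : η / (4 * (Q + 1)) * Q ≤ η / 4 := by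
  rw [div_mul_eq_mul_div, div_le_div_iff₀ (by positivity) (by positivity)]
  nlinarith [mul_nonneg hη hQ]

/-- `Q · a ≤ η/4` for `0 ≤ Q`, `0 ≤ a ≤ η/(4(Q+1))`. [folklore] -/
theorem mul_le_div_four {η Q a : ℝ} (hQ : 0 ≤ Q) (ha : 0 ≤ a) (ha1 : a ≤ η / (4 * (Q + 1))) :
    Q * a ≤ η / 4 := by
  calc Q * a ≤ (Q + 1) * a := by nlinarith
    _ ≤ (Q + 1) * (η / (4 * (Q + 1))) := mul_le_mul_of_nonneg_left ha1 (by positivity)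
    _ = η / 4 := by field_simp

/-- `c · w ≤ κ` for `0 ≤ c`, `w ≤ a`, `0 ≤ a ≤ κ/(c+1)`. [folklore] -/
theorem mul_le_of_le_div_add_one {c w a κ : ℝ} (hc : 0 ≤ c) (hw : w ≤ a) (ha : 0 ≤ a)
    (haκ : a ≤ κ / (c + 1)) : c * w ≤ κ := by
  calc c * w ≤ c * a := mul_le_mul_of_nonneg_left hw hc
    _ ≤ (c + 1) * a := by nlinarith
    _ ≤ (c + 1) * (κ / (c + 1)) := mul_le_mul_of_nonneg_left haκ (by positivity)
    _ = κ := by field_simp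

/-- **The four error terms of the pathwise estimate are each `≤ η/4`** for the choice of the moduli
`ϵ₁ = η/(4(σ³τC_G M_B + 1))`, `ϵ₂ = η/(4(σ³τC_χ + 1))` and of the window fraction
`a ≤ η/(4(X₃+1))`, `a ≤ η/(4(σ²C₂K_b' + 1))` (`X₃ = 8πσ³τC_χC_G L M K'`, `C₂ = 4πC_χC_G M²`), given
`w ≤ a q`, `q ≤ 1`, `ε = σ q` (so `w ≤ a`, `w/ε ≤ a/σ`) and `(ε/n)·CPS([0,τ]) ≤ K_b'`, `CPS((0,τ]) ≤ CPS([0,τ])`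
(pure real arithmetic, isolated from the measure-theoretic context). [folklore] -/
theorem le_eta_of_four_terms {σ τ η a w q ε n Cχ CG K' Kb' M L V MB C₂ X₃ ϵ₁ ϵ₂ CPSo CPSc T : ℝ}
    (hσ : 0 < σ) (hτ : 0 < τ) (hη : 0 < η) (ha : 0 < a) (hn : 0 < n) (hε : 0 < ε) (hεq : ε = σ * q)
    (hCχ0 : 0 ≤ Cχ) (hCG0 : 0 ≤ CG) (hK'0 : 0 ≤ K') (hKb'0 : 0 ≤ Kb') (hM0 : 0 ≤ M) (hL0 : 0 ≤ L)
    (hV0 : 0 ≤ V) (hMB : MB = 2 * Real.pi * M ^ 2 * V) (hC₂ : C₂ = 4 * Real.pi * Cχ * CG * M ^ 2)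
    (hX₃ : X₃ = 8 * Real.pi * σ ^ 3 * τ * Cχ * CG * L * M * K')
    (hϵ₁ : ϵ₁ = η / (4 * (σ ^ 3 * τ * CG * MB + 1))) (hϵ₂ : ϵ₂ = η / (4 * (σ ^ 3 * τ * Cχ + 1)))
    (hwq : w ≤ a * q) (hq1 : q ≤ 1) (hw0 : 0 ≤ w)
    (ha3 : a ≤ η / (4 * (X₃ + 1))) (ha4 : a ≤ η / (4 * (σ ^ 2 * C₂ * Kb' + 1)))
    (hCPSo0 : 0 ≤ CPSo) (hCPS : CPSo ≤ CPSc) (hCPSc : ε / n * CPSc ≤ Kb')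
    (hT : T ≤ σ ^ 3 * (τ * (ϵ₁ * CG * MB + Cχ * ϵ₂ + 8 * Real.pi * Cχ * CG * L * M * K' * w) +
      4 * Real.pi * Cχ * CG * M ^ 2 * (w / n) * CPSo)) :
    T ≤ η := by
  have hMB0 : 0 ≤ MB := by rw [hMB]; positivity
  have hC₂0 : 0 ≤ C₂ := by rw [hC₂]; positivity
  have hX₃0 : 0 ≤ X₃ := by rw [hX₃]; positivity
  have hwa : w ≤ a := hwq.trans (mul_le_of_le_one_right ha.le hq1)
  have h1 : σ ^ 3 * τ * (ϵ₁ * CG * MB) ≤ η / 4 := by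
    calc σ ^ 3 * τ * (ϵ₁ * CG * MB) = η / (4 * (σ ^ 3 * τ * CG * MB + 1)) * (σ ^ 3 * τ * CG * MB) := by
          rw [hϵ₁]; ring
      _ ≤ η / 4 := div_four_mul_le hη.le (by positivity)
  have h2 : σ ^ 3 * τ * (Cχ * ϵ₂) ≤ η / 4 := by
    calc σ ^ 3 * τ * (Cχ * ϵ₂) = η / (4 * (σ ^ 3 * τ * Cχ + 1)) * (σ ^ 3 * τ * Cχ) := by rw [hϵ₂]; ring
      _ ≤ η / 4 := div_four_mul_le hη.le (by positivity)
  have h3 : σ ^ 3 * τ * (8 * Real.pi * Cχ * CG * L * M * K' * w) ≤ η / 4 := by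
    calc σ ^ 3 * τ * (8 * Real.pi * Cχ * CG * L * M * K' * w) = X₃ * w := by rw [hX₃]; ring
      _ ≤ X₃ * a := mul_le_mul_of_nonneg_left hwa hX₃0
      _ ≤ η / 4 := mul_le_div_four hX₃0 ha.le ha3
  have hwε : w / ε ≤ a / σ := by
    rw [div_le_div_iff₀ hε hσ, hεq]
    calc w * σ ≤ a * q * σ := mul_le_mul_of_nonneg_right hwq hσ.le
      _ = a * (σ * q) := by ring
  have h4 : σ ^ 3 * (4 * Real.pi * Cχ * CG * M ^ 2 * (w / n) * CPSo) ≤ η / 4 := by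
    have s2 : w / n * CPSc = w / ε * (ε / n * CPSc) := by field_simp
    calc σ ^ 3 * (4 * Real.pi * Cχ * CG * M ^ 2 * (w / n) * CPSo) = σ ^ 3 * C₂ * (w / n * CPSo) := by
          rw [hC₂]; ring
      _ ≤ σ ^ 3 * C₂ * (w / n * CPSc) :=
          mul_le_mul_of_nonneg_left (mul_le_mul_of_nonneg_left hCPS (by positivity)) (by positivity)
      _ = σ ^ 3 * C₂ * (w / ε * (ε / n * CPSc)) := by rw [s2]
      _ ≤ σ ^ 3 * C₂ * (a / σ * Kb') :=
          mul_le_mul_of_nonneg_left (mul_le_mul hwε hCPSc (mul_nonneg (by positivity) (hCPSo0.trans hCPS))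
            (by positivity)) (by positivity)
      _ = σ ^ 2 * C₂ * Kb' * a := by field_simp
      _ ≤ η / 4 := mul_le_div_four (by positivity) ha.le ha4
  have e : σ ^ 3 * (τ * (ϵ₁ * CG * MB + Cχ * ϵ₂ + 8 * Real.pi * Cχ * CG * L * M * K' * w) +
      4 * Real.pi * Cχ * CG * M ^ 2 * (w / n) * CPSo) =
      σ ^ 3 * τ * (ϵ₁ * CG * MB) + σ ^ 3 * τ * (Cχ * ϵ₂) +
        σ ^ 3 * τ * (8 * Real.pi * Cχ * CG * L * M * K' * w) +
        σ ^ 3 * (4 * Real.pi * Cχ * CG * M ^ 2 * (w / n) * CPSo) := by ring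
  linarith

/-! ## The registered stub -/

/-- **S4b · window reduction, Enskog side** (registered stub `stub_windowReductionEnskog` of the line `Sketch`,
verbatim).  Given `CollisionMomentBound`: with the band `η₄` of `exists_band_mul_contactValue`, for continuous
positive profiles, `σ < σ₀ := min σ_K σ_M` (the thresholds of `stub_kineticEnergyTight` and of
`CollisionMomentBound`), all flows, `τ > 0`, continuous `χ`, continuous `g = 0` on `[η₄, ∞)`, `η, δ, r > 0`,
there is `a₁ > 0` such that for `a ∈ (0, a₁)` and `N ≥ max N_K N_M`:
`P_{LG}(η < |σ³∫_{[0,τ]} e_s(Φ_s z) ds − riemannEnskog σ N Φ τ a χ g r z|) ≤ δ`.  The pathwise estimate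
`abs_enskogIntegral_sub_riemannEnskog_le` bounds the difference on {good} ∩ {E ≤ K(N+1)} ∩ {K_N ≤ K_b} by four
terms each `≤ η/4` for `a < a₁` (`w ≤ a`, `w/ε ≤ a/σ`, `CPS((0,τ]) ≤ CPS([0,τ]) = (N+1)ε⁻¹ K_N`); the
complement of that event has probability `≤ 0 + δ/2 + δ/2`. [cite: CIPDiluteGases1994, App. 4.A] -/
theorem stub_windowReductionEnskog :
    CollisionMomentBound →
    ∃ η₄ : ℝ, 0 < η₄ ∧ ∀ (a₀ θ₀ : T3 → ℝ) (u₀ : T3 → V3), Continuous a₀ → Continuous θ₀ → Continuous u₀ →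
      (∀ x, 0 < a₀ x) → (∀ x, 0 < θ₀ x) → ∃ σ₀ : ℝ, 0 < σ₀ ∧ ∀ σ : ℝ, 0 < σ → σ < σ₀ →
      ∀ Φ : (N : ℕ) → HardSphereFlow (Torus.geometry (Fin 3)) (hsDiameter σ N) (N + 1),
      ∀ τ : ℝ, 0 < τ → ∀ χ : ℝ × T3 → ℝ, Continuous χ → ∀ g : ℝ → ℝ, Continuous g →
      (∀ x, η₄ ≤ x → g x = 0) →
      ∀ η δ : ℝ, 0 < η → 0 < δ → ∀ r : ℝ, 0 < r →
      ∃ a₁ : ℝ, 0 < a₁ ∧ ∀ a : ℝ, 0 < a → a < a₁ → ∃ N₀ : ℕ, ∀ N : ℕ, N₀ ≤ N →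
        localGibbsLaw σ a₀ u₀ θ₀ N (Φ N)
          {z | η < |σ ^ 3 * (∫ s in Set.Icc (0 : ℝ) τ, enskogRate σ N χ g (fun _ => 1) r s ((Φ N).flow s z)) -
              riemannEnskog σ N (Φ N) τ a χ g r z|}
          ≤ ENNReal.ofReal δ := by
  intro hCMB
  obtain ⟨η₄, hη₄, hband⟩ := exists_band_mul_contactValue
  refine ⟨η₄, hη₄, fun a₀ θ₀ u₀ ha hθ hu ha0 hθ0 => ?_⟩
  obtain ⟨σK, hσK, HK⟩ := stub_kineticEnergyTight a₀ θ₀ u₀ ha hθ hu ha0 hθ0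
  obtain ⟨σM, hσM, HM⟩ := hCMB a₀ θ₀ u₀ ha hθ hu ha0 hθ0
  refine ⟨min σK σM, lt_min hσK hσM, fun σ hσ hσlt Φ τ hτ χ hχ g hg hg0 η δ hη hδ r hr => ?_⟩
  have hσK' : σ < σK := hσlt.trans_le (min_le_left _ _)
  have hσM' : σ < σM := hσlt.trans_le (min_le_right _ _)
  -- constants attached to `χ` and `g`
  obtain ⟨hGc, CG, hCG0, hGb⟩ := hband g hg hg0
  have hG0 : ∀ b, η₄ ≤ b → g b * contactValue b = 0 := fun b hb => by rw [hg0 b hb, zero_mul]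
  obtain ⟨Cχ, hCχ0, hχb⟩ : ∃ Cχ : ℝ, 0 ≤ Cχ ∧ ∀ s ∈ Icc (0 : ℝ) τ, ∀ y, |χ (s, y)| ≤ Cχ := by
    obtain ⟨C, hC⟩ := (isCompact_Icc.prod isCompact_univ :
      IsCompact (Icc (0 : ℝ) τ ×ˢ (univ : Set T3))).exists_bound_of_continuousOn hχ.continuousOn
    refine ⟨max C 0, le_max_right _ _, fun s hs y => ?_⟩
    have h := hC (s, y) ⟨hs, mem_univ _⟩
    rw [Real.norm_eq_abs] at h
    exact h.trans (le_max_left _ _)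
  -- the two tightness inputs, each at level `δ/2`
  obtain ⟨K, NK, hKev⟩ := HK σ hσ hσK' Φ (δ / 2) (half_pos hδ)
  obtain ⟨Kb, NM, hMev⟩ := HM σ hσ hσM' Φ τ hτ (δ / 2) (half_pos hδ)
  obtain ⟨K', hKK', hK'0⟩ : ∃ K' : ℝ, K ≤ K' ∧ 0 ≤ K' := ⟨max K 0, le_max_left _ _, le_max_right _ _⟩
  obtain ⟨Kb', hKbKb', hKb'0⟩ : ∃ Kb' : ℝ, Kb ≤ Kb' ∧ 0 ≤ Kb' :=
    ⟨max Kb 0, le_max_left _ _, le_max_right _ _⟩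
  -- derived constants
  obtain ⟨M, hM⟩ : ∃ M : ℝ, M = 3 / (Real.pi * r ^ 3) := ⟨_, rfl⟩
  obtain ⟨L, hL⟩ : ∃ L : ℝ, L = 3 / (Real.pi * r ^ 4) := ⟨_, rfl⟩
  obtain ⟨V, hV⟩ : ∃ V : ℝ, V = Real.sqrt (2 * K') := ⟨_, rfl⟩
  have hM0 : 0 < M := by rw [hM]; positivity
  have hL0 : 0 < L := by rw [hL]; positivity
  have hV0 : 0 ≤ V := by rw [hV]; exact Real.sqrt_nonneg _
  obtain ⟨MB, hMB⟩ : ∃ MB : ℝ, MB = 2 * Real.pi * M ^ 2 * V := ⟨_, rfl⟩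
  obtain ⟨C₂, hC₂⟩ : ∃ C₂ : ℝ, C₂ = 4 * Real.pi * Cχ * CG * M ^ 2 := ⟨_, rfl⟩
  obtain ⟨X₃, hX₃⟩ : ∃ X₃ : ℝ, X₃ = 8 * Real.pi * σ ^ 3 * τ * Cχ * CG * L * M * K' := ⟨_, rfl⟩
  have hMB0 : 0 ≤ MB := by rw [hMB]; positivity
  have hC₂0 : 0 ≤ C₂ := by rw [hC₂]; positivity
  have hX₃0 : 0 ≤ X₃ := by rw [hX₃]; positivity
  -- the two moduli
  obtain ⟨ϵ₁, hϵ₁⟩ : ∃ ϵ₁ : ℝ, ϵ₁ = η / (4 * (σ ^ 3 * τ * CG * MB + 1)) := ⟨_, rfl⟩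
  obtain ⟨ϵ₂, hϵ₂⟩ : ∃ ϵ₂ : ℝ, ϵ₂ = η / (4 * (σ ^ 3 * τ * Cχ + 1)) := ⟨_, rfl⟩
  have hϵ₁0 : 0 < ϵ₁ := by rw [hϵ₁]; positivity
  have hϵ₂0 : 0 < ϵ₂ := by rw [hϵ₂]; positivity
  obtain ⟨κχ, hκχ, hχmod⟩ := exists_time_modulus hχ τ hϵ₁0
  obtain ⟨κG, hκG, hGmod⟩ := exists_modulus_mul_le (D := 2 * Real.pi * (3 / (Real.pi * r ^ 3)) *
    Real.sqrt (2 * K') / σ ^ 3) (M := 2 * Real.pi * (3 / (Real.pi * r ^ 3)) ^ 2 * Real.sqrt (2 * K'))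
    hGc hG0 hGb (by positivity) (by positivity) hϵ₂0
  -- the window fraction threshold
  refine ⟨min (min (κχ / 2) (κG / (σ ^ 3 * L * V + 1)))
    (min (η / (4 * (X₃ + 1))) (η / (4 * (σ ^ 2 * C₂ * Kb' + 1)))), by positivity,
    fun a ha0' ha1 => ⟨max NK NM, fun N hN => ?_⟩⟩
  have haχ : a < κχ := by
    have : a < κχ / 2 := lt_of_lt_of_le ha1 ((min_le_left _ _).trans (min_le_left _ _))
    linarith
  have haG : a ≤ κG / (σ ^ 3 * L * V + 1) := (ha1.le.trans (min_le_left _ _)).trans (min_le_right _ _)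
  have ha3 : a ≤ η / (4 * (X₃ + 1)) := (ha1.le.trans (min_le_right _ _)).trans (min_le_left _ _)
  have ha4 : a ≤ η / (4 * (σ ^ 2 * C₂ * Kb' + 1)) :=
    (ha1.le.trans (min_le_right _ _)).trans (min_le_right _ _)
  have hNK : NK ≤ N := (le_max_left _ _).trans hN
  have hNM : NM ≤ N := (le_max_right _ _).trans hN
  -- window length versus `a` and versus the diameter
  obtain ⟨w, hw⟩ : ∃ w : ℝ, w = windowLen N τ a := ⟨_, rfl⟩
  obtain ⟨q, hq, hε⟩ : ∃ q : ℝ, q = ((N + 1 : ℕ) : ℝ) ^ (-(1 / 3 : ℝ)) ∧ hsDiameter σ N = σ * q :=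
    ⟨_, rfl, rfl⟩
  have hq1 : q ≤ 1 := by
    rw [hq]
    exact Real.rpow_le_one_of_one_le_of_nonpos (by exact_mod_cast Nat.succ_pos N) (by norm_num)
  have hwq : w ≤ a * q := by rw [hw, hq]; exact windowLen_le N hτ ha0'
  have hwa : w ≤ a := hwq.trans (mul_le_of_le_one_right ha0'.le hq1)
  have hw0 : 0 ≤ w := by rw [hw]; exact (windowLen_pos N hτ ha0').le
  have hεpos : 0 < hsDiameter σ N := hsDiameter_pos hσ N
  have hn : (0 : ℝ) < ((N + 1 : ℕ) : ℝ) := by exact_mod_cast Nat.succ_pos N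
  -- the three events
  have hK1 := hKev N hNK 0
  have hM1 := hMev N hNM
  simp only [] at hM1
  obtain ⟨EK, hEK⟩ : ∃ EK : Set (Config (N + 1) (Fin 3) T3),
      EK = {z | K < ((N : ℝ) + 1)⁻¹ * configEnergy ((Φ N).flow 0 z)} := ⟨_, rfl⟩
  obtain ⟨EM, hEM⟩ : ∃ EM : Set (Config (N + 1) (Fin 3) T3), EM = {z | Kb < hsDiameter σ N / (N + 1 : ℝ) *
    ∑ᶠ (s : ℝ) (_ : s ∈ collisionTimes (Torus.geometry (Fin 3)) (hsDiameter σ N) (fun s => (Φ N).flow s z) ∩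
      Set.Icc 0 τ), ∑ i : Fin (N + 1), ∑ j : Fin (N + 1),
        (if i ≠ j ∧ ‖(Torus.geometry (Fin 3)).sepVec ((Φ N).flow s z i).1 ((Φ N).flow s z j).1‖ =
          hsDiameter σ N then 1 + ‖((Φ N).flow s z i).2‖ ^ 2 + ‖((Φ N).flow s z j).2‖ ^ 2 else 0)} :=
    ⟨_, rfl⟩
  have hPK : localGibbsLaw σ a₀ u₀ θ₀ N (Φ N) EK ≤ ENNReal.ofReal (δ / 2) := by rw [hEK]; exact hK1
  have hPM : localGibbsLaw σ a₀ u₀ θ₀ N (Φ N) EM ≤ ENNReal.ofReal (δ / 2) := by rw [hEM]; exact hM1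
  have hP0 : localGibbsLaw σ a₀ u₀ θ₀ N (Φ N) (Φ N).goodᶜ = 0 := localGibbsLaw_compl_good_eq_zero (Φ N)
  -- the inclusion: off the three events the pathwise bound gives `|…| ≤ η`
  have hsub : {z | η < |σ ^ 3 * (∫ s in Set.Icc (0 : ℝ) τ,
      enskogRate σ N χ g (fun _ => 1) r s ((Φ N).flow s z)) - riemannEnskog σ N (Φ N) τ a χ g r z|} ⊆
      ((Φ N).goodᶜ ∪ EK) ∪ EM := by
    intro z hz
    by_contra hnot
    simp only [mem_union, not_or] at hnot
    obtain ⟨⟨hgood, hzK⟩, hzM⟩ := hnot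
    have hzg : z ∈ (Φ N).good := not_notMem.1 hgood
    rw [hEK] at hzK
    rw [hEM] at hzM
    simp only [mem_setOf_eq, not_lt] at hzK hzM
    -- energy
    have hEz : configEnergy z ≤ K' * ((N + 1 : ℕ) : ℝ) := by
      rw [(Φ N).flow_zero z hzg, inv_mul_le_iff₀ (by positivity)] at hzK
      calc configEnergy z ≤ ((N : ℝ) + 1) * K := hzK
        _ ≤ ((N : ℝ) + 1) * K' := mul_le_mul_of_nonneg_left hKK' (by positivity)
        _ = K' * ((N + 1 : ℕ) : ℝ) := by push_cast; ring
    -- the collision functional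
    have hdom : ∀ t, (fun s => (Φ N).flow s z) t ∈ hardSphereDomain (Torus.geometry (Fin 3)) (N + 1)
        (hsDiameter σ N) := ((Φ N).isTrajectory z hzg).mem
    have hCPSc : hsDiameter σ N / ((N + 1 : ℕ) : ℝ) *
        collisionPairSum (Torus.geometry (Fin 3)) (hsDiameter σ N) (fun s => (Φ N).flow s z) (Icc 0 τ)
          (fun t i j => 1 + ‖((Φ N).flow t z i).2‖ ^ 2 + ‖((Φ N).flow t z j).2‖ ^ 2) ≤ Kb' := by
      rw [collisionPairSum_eq_finsum_ite hdom, Nat.cast_succ]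
      exact hzM.trans hKbKb'
    have hCPSo := collisionPairSum_mono_set (((Φ N).isTrajectory z hzg).locFinite 0 τ)
      (Ioc_subset_Icc_self : Ioc (0 : ℝ) τ ⊆ Icc 0 τ)
      (g := fun t i j => 1 + ‖((Φ N).flow t z i).2‖ ^ 2 + ‖((Φ N).flow t z j).2‖ ^ 2)
      fun t i j => by positivity
    -- the pathwise estimate
    have hκ : σ ^ 3 * (3 / (Real.pi * r ^ 4)) * Real.sqrt (2 * K') * windowLen N τ a ≤ κG := by
      rw [← hL, ← hV, ← hw]
      exact mul_le_of_le_div_add_one (by positivity) hwa ha0'.le haG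
    have hχω : ∀ s ∈ Icc (0 : ℝ) τ, ∀ s' ∈ Icc (0 : ℝ) τ, |s - s'| ≤ windowLen N τ a →
        ∀ y, |χ (s, y) - χ (s', y)| ≤ ϵ₁ :=
      fun s hs s' hs' hss' y => hχmod s hs s' hs' (lt_of_le_of_lt (hss'.trans (hw ▸ hwa)) haχ) y
    have hpath := abs_enskogIntegral_sub_riemannEnskog_le (Φ N) hzg hχ hg hσ hr hτ ha0' hχb hχω hGb hK'0 hEz
      hGmod hκ
    rw [← hM, ← hL, ← hV, ← hw, ← hMB] at hpath
    have htot := le_eta_of_four_terms hσ hτ hη ha0' hn hεpos hε hCχ0 hCG0 hK'0 hKb'0 hM0.le hL0.le hV0 hMB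
      hC₂ hX₃ hϵ₁ hϵ₂ hwq hq1 hw0 ha3 ha4 (collisionPairSum_nonneg fun t i j => by positivity) hCPSo hCPSc
      hpath
    exact (not_lt.2 htot) hz
  -- the union bound
  calc localGibbsLaw σ a₀ u₀ θ₀ N (Φ N) {z | η < |σ ^ 3 * (∫ s in Set.Icc (0 : ℝ) τ,
          enskogRate σ N χ g (fun _ => 1) r s ((Φ N).flow s z)) - riemannEnskog σ N (Φ N) τ a χ g r z|}
      ≤ localGibbsLaw σ a₀ u₀ θ₀ N (Φ N) (((Φ N).goodᶜ ∪ EK) ∪ EM) := measure_mono hsub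
    _ ≤ localGibbsLaw σ a₀ u₀ θ₀ N (Φ N) ((Φ N).goodᶜ ∪ EK) + localGibbsLaw σ a₀ u₀ θ₀ N (Φ N) EM :=
        measure_union_le _ _
    _ ≤ (localGibbsLaw σ a₀ u₀ θ₀ N (Φ N) (Φ N).goodᶜ + localGibbsLaw σ a₀ u₀ θ₀ N (Φ N) EK) +
          localGibbsLaw σ a₀ u₀ θ₀ N (Φ N) EM := add_le_add (measure_union_le _ _) le_rfl
    _ ≤ (0 + ENNReal.ofReal (δ / 2)) + ENNReal.ofReal (δ / 2) :=
        add_le_add (add_le_add hP0.le hPK) hPM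
    _ = ENNReal.ofReal δ := by
        rw [zero_add, ← ENNReal.ofReal_add (half_pos hδ).le (half_pos hδ).le, add_halves]

end Summit.AtomisticToContinuum.HydrodynamicLimit.Theorems.CollisionRate

end
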